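import Mathlib
import HarnessLib
import Summits.HubbardSuperconductivity.Statement
import Summits.HubbardSuperconductivity.HubbardSuperconductivity.Theses.WeakCouplingBCS
import Literature.MathematicalPhysics.QuantumLattice.PairCorrelationsProofs
import Literature.MathematicalPhysics.QuantumLattice.LatticeToriLROProofs
import Literature.Barriers.HubbardSuperconductivity.PureModelStripeCompetitionProofs
import Summits.HubbardSuperconductivity.HubbardSuperconductivity.Theorems.WeakCouplingBCSWcbcsThesisGlue

/-!
(buildfix 2026-08-20, maintenance re-land: the route restated `WcbcsThesis`, `WcbcsSsbToTorusLRO`,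
`WcbcsBcsConstruction` BY NAME on 2026-08-15 (revs 2–4). Of the six declarations that mention them,
`wcbcsThesis_imp_forall_hasDWavePairFieldLROAt`, `wcbcsThesis_imp_summitShape_Ioo_one` and `wcbcsThesis_of_cruxes`
keep their statements with new proofs; `wcbcsThesis_of_eventually_le`, `not_wcbcsThesis_iff` and
`exists_admissible_hasPairFieldLRO_of_wcbcsThesis` analysed the rev-1 body and are removed — see the comments at
their former places. Everything else is byte-identical.)

# Route `WeakCouplingBCS`, thesis `WcbcsThesis` (item `stmt-HubbardSuperconductivity-0120`): glue and reductions

The thesis `X = WcbcsThesis` of the route (`∃ U₀ > 0, ∃ δ ∈ (0,1), ∀ U ∈ (0,U₀)`, every sequence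
`(N_L, ψ_L)_L` of normalised `(N_L, S^z = 0)`-sector ground states of `hubbardTorus 2 L 1 U`,
`N_L = 2⌊(1-δ)L²/2⌋`, admissible at ALL sides `L`, has `HasPairFieldLRO dWaveFormFactor N ψ`) is
open mathematics (weak-coupling `d_{x²-y²}` superconductivity of the 2D Hubbard model). This file
records, sorry-free, the LOGICAL position of `X` inside the route and against the summit:

* `liminf_comp_pos_of_le` — a real sequence bounded above with positive `liminf` keeps a positive
  `liminf` along any subsequence (the upper bound keeps Mathlib's real `liminf` off its junk value).
* `hasDWavePairFieldLROAt_of_forall_hasPairFieldLRO` — for fixed `(U, δ)`, `δ ≥ -1`: if every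
  sequence admissible at ALL `L` has `HasPairFieldLRO dWaveFormFactor`, then the summit's matrix
  `HasDWavePairFieldLROAt U δ` (admissible at EVEN `L` only, LRO along even sides) holds. The odd
  sides are filled with the ground states of `exists_unit_isGroundStateInSector_hubbardTorus`, the
  `liminf` is passed to the even subsequence with the a-priori bound `pairFieldCorr_succ_le`.
* `wcbcsThesis_imp_forall_hasDWavePairFieldLROAt`, `wcbcsThesis_imp_summitShape_Ioo_one` — hence
  `X` implies the summit-shaped statement with doping range `(0, 1)` in place of the summit's
  `(0, 1/2)`: the route's `Assembly : X → HubbardSuperconductivity` is short of pure logic EXACTLY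
  by the doping range of `X` (a witness `δ ≥ 1/2` of `X` is not excluded by `X`).
* `hubbardSuperconductivity_of_wcbcsThesis_half`, `hubbardSuperconductivity_of_evenThesis_half` —
  the thesis restated with `δ ∈ (0, 1/2)` (all-`L` or even-`L` admissibility) implies the summit
  outright: the assembly the planner intended.
* `wcbcsThesis_of_cruxes` — the route's internal glue: crux #2 (`WcbcsSsbToTorusLRO`, SSB ⇒ torus
  LRO for every sector ground state) and crux #4 (`WcbcsBcsConstruction`, `m(U, δ) ≥ e^{-C/U²}`)
  imply `X` (bookkeeping via `mem_szSector_iff` and `hasPairFieldLRO_iff_liminf_holds`).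

Nothing here proves `X`; the theorems are `--supports` helpers for item 0120 (and document the
repair needed in item 0156).
-/

noncomputable section

namespace Summit.HubbardSuperconductivity.HubbardSuperconductivity.Theorems

open Filter Finset Matrix
open Literature.Probability.LatticeModels Literature.MathematicalPhysics.QuantumLattice
open Literature.Barriers.HubbardSuperconductivity
open Summit.HubbardSuperconductivity.HubbardSuperconductivity.Theses.WeakCouplingBCS
open scoped ComplexOrder

/-! ### A positive real `liminf` survives along subsequences (given an upper bound) -/

/-- If a real sequence `u` is bounded above and `0 < liminf u`, then `0 < liminf (u ∘ φ)` for
every `φ → ∞`. The upper bound is needed because Mathlib's real `liminf` of a sequence unbounded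
above along the subsequence would be the junk value `sSup univ = 0`. [folklore] -/
theorem liminf_comp_pos_of_le {u : ℕ → ℝ} {B : ℝ} (hB : ∀ n, u n ≤ B)
    (hu : 0 < liminf u atTop) {φ : ℕ → ℕ} (hφ : Tendsto φ atTop atTop) :
    0 < liminf (u ∘ φ) atTop := by
  rw [Filter.liminf_eq] at hu
  have hne : {a : ℝ | ∀ᶠ n in atTop, a ≤ u n}.Nonempty := by
    by_contra h
    rw [Set.not_nonempty_iff_eq_empty] at h
    rw [h, Real.sSup_empty] at hu
    exact lt_irrefl _ hu
  obtain ⟨c, hcS, hc⟩ := exists_lt_of_lt_csSup hne hu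
  have hev : ∀ᶠ k in atTop, c ≤ (u ∘ φ) k := hφ.eventually hcS
  exact lt_of_lt_of_le hc (le_liminf_of_le (isCoboundedUnder_ge_of_eventually_le _
    (Eventually.of_forall fun k => hB (φ k))) hev)

/-! ### From all-`L` pair-field LRO to the summit's even-`L` matrix -/

/-- The pair-field two-point function at side `L` depends on the state at side `L` only.
[folklore] -/
theorem pairFieldCorr_congr (g : Site 2 → ℝ) {ψ ψ' : ∀ L, Fock (Orb (FermionTorus 2 L))}
    {L : ℕ} (h : ψ L = ψ' L) : pairFieldCorr g ψ L = pairFieldCorr g ψ' L := by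
  funext x y
  cases L with
  | zero => simp [pairFieldCorr]
  | succ n => simp only [pairFieldCorr_succ, h]

/-- A-priori bound on the long-range-order sequence of the pair field: for a family of states
normalised at every positive side, `|Λ_L|⁻² Σ_{x,y ∈ Λ_L} G_L(x,y) ≤ C_g²` for every `L`
(`C_g` the crude bound of `pairFieldCorr_succ_le`; at `L = 0` the term is the junk value `0`).
Scalapino, Phys. Rep. 250 (1995) 329, §2. [folklore] -/
theorem lroSeq_pairFieldCorr_le (g : Site 2 → ℝ) (ψ : ∀ L, Fock (Orb (FermionTorus 2 L)))
    (hψ : ∀ L, star (ψ (L + 1)) ⬝ᵥ ψ (L + 1) = 1) (L : ℕ) :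
    (∑ x ∈ halfOpenBox 2 L, ∑ y ∈ halfOpenBox 2 L, torusPullback (pairFieldCorr g ψ) L x y) /
        ((halfOpenBox 2 L).card : ℝ) ^ 2 ≤
      (∑ e ∈ insert 0 unitSteps, ‖((g e / Real.sqrt 2 : ℝ) : ℂ)‖ * 2) ^ 2 := by
  cases L with
  | zero =>
    have h0 : ((halfOpenBox 2 0).card : ℝ) ^ 2 = 0 := by rw [card_halfOpenBox]; simp
    rw [h0, div_zero]
    positivity
  | succ n =>
    rw [sum_torusPullback_succ, div_le_iff₀ (by positivity)]
    calc ∑ x : TorusSite 2 (n + 1), ∑ y : TorusSite 2 (n + 1), pairFieldCorr g ψ (n + 1) x y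
        ≤ ∑ x : TorusSite 2 (n + 1), ∑ y : TorusSite 2 (n + 1),
            (∑ e ∈ insert 0 unitSteps, ‖((g e / Real.sqrt 2 : ℝ) : ℂ)‖ * 2) ^ 2 :=
          Finset.sum_le_sum fun x _ => Finset.sum_le_sum fun y _ =>
            pairFieldCorr_succ_le g ψ n (hψ n) x y
      _ = (∑ e ∈ insert 0 unitSteps, ‖((g e / Real.sqrt 2 : ℝ) : ℂ)‖ * 2) ^ 2 *
            ((n + 1 : ℕ) : ℝ) ^ (2 * 2) := by
          simp only [Finset.sum_const, Finset.card_univ, Fintype.card_pi, ZMod.card,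
            Finset.prod_const, Fintype.card_fin]
          push_cast
          ring

/-- **All-`L` pair-field LRO of every admissible sequence implies the summit's matrix.** Fix a
coupling `U` and a doping `δ ≥ -1`. If EVERY sequence `(N_L, ψ_L)_L` of normalised
`(N_L, S^z = 0)`-sector ground states of `hubbardTorus 2 L 1 U`, `N_L = 2⌊(1-δ)L²/2⌋`, admissible
at ALL sides `L`, has `d_{x²-y²}` pair-field long-range order (`HasPairFieldLRO`, `liminf` over all
`L`), then `HasDWavePairFieldLROAt U δ`: every sequence admissible at the EVEN sides has LRO along
the even sides. Proof: replace the states at odd `L` by normalised sector ground states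
(`exists_unit_isGroundStateInSector_hubbardTorus`), apply the hypothesis, and pass the positive
`liminf` to the subsequence `L = 2k` (`liminf_comp_pos_of_le` with `lroSeq_pairFieldCorr_le`).
[folklore] -/
theorem hasDWavePairFieldLROAt_of_forall_hasPairFieldLRO {U δ : ℝ} (hδ : -1 ≤ δ)
    (h : ∀ (N : ℕ → ℕ) (ψ : ∀ L, Fock (Orb (FermionTorus 2 L))),
      (∀ L, N L = 2 * ⌊(1 - δ) * (L : ℝ) ^ 2 / 2⌋₊ ∧ star (ψ L) ⬝ᵥ ψ L = 1 ∧
          IsGroundStateInSector (hubbardTorus 2 L 1 U) (N L) 0 (ψ L)) →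
        HasPairFieldLRO dWaveFormFactor N ψ) :
    HasDWavePairFieldLROAt U δ := by
  classical
  intro N ψ hE
  have key : ∀ L : ℕ, ∃ φ : Fock (Orb (FermionTorus 2 L)), star φ ⬝ᵥ φ = 1 ∧
      IsGroundStateInSector (hubbardTorus 2 L 1 U) (2 * ⌊(1 - δ) * (L : ℝ) ^ 2 / 2⌋₊) 0 φ :=
    fun L => exists_unit_isGroundStateInSector_hubbardTorus U L _ (natFloor_filling_le_sq hδ L)
  choose φ hφ using key
  -- the modified family: `ψ` at even sides, the chosen ground states at odd sides
  let ψ' : ∀ L, Fock (Orb (FermionTorus 2 L)) := fun L => if Even L then ψ L else φ L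
  have hψ'_even : ∀ L, Even L → ψ' L = ψ L := fun L hL => by simp [ψ', hL]
  have hψ'_odd : ∀ L, ¬ Even L → ψ' L = φ L := fun L hL => by simp [ψ', hL]
  -- the prescribed particle numbers, at every side
  let N' : ℕ → ℕ := fun L => 2 * ⌊(1 - δ) * (L : ℝ) ^ 2 / 2⌋₊
  have hHYP : ∀ L, N' L = 2 * ⌊(1 - δ) * (L : ℝ) ^ 2 / 2⌋₊ ∧ star (ψ' L) ⬝ᵥ ψ' L = 1 ∧
      IsGroundStateInSector (hubbardTorus 2 L 1 U) (N' L) 0 (ψ' L) := by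
    intro L
    refine ⟨rfl, ?_⟩
    show star (ψ' L) ⬝ᵥ ψ' L = 1 ∧
      IsGroundStateInSector (hubbardTorus 2 L 1 U) (2 * ⌊(1 - δ) * (L : ℝ) ^ 2 / 2⌋₊) 0 (ψ' L)
    by_cases hL : Even L
    · obtain ⟨hN, hnorm, hGS⟩ := hE L hL
      rw [hψ'_even L hL, ← hN]
      exact ⟨hnorm, hGS⟩
    · rw [hψ'_odd L hL]
      exact hφ L
  obtain ⟨hnorm', hLRO⟩ := h N' ψ' hHYP
  unfold HasTorusLRO HasLongRangeOrder at hLRO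
  unfold HasLongRangeOrder
  have hbound := lroSeq_pairFieldCorr_le dWaveFormFactor ψ' (fun L => (hnorm' (L + 1)).2)
  have hsub := liminf_comp_pos_of_le hbound hLRO (φ := fun k => 2 * k)
    (tendsto_id.const_mul_atTop' two_pos)
  have heq : (fun k : ℕ => (∑ x ∈ halfOpenBox 2 (2 * k), ∑ y ∈ halfOpenBox 2 (2 * k),
      torusPullback (pairFieldCorr dWaveFormFactor ψ) (2 * k) x y) /
        ((halfOpenBox 2 (2 * k)).card : ℝ) ^ 2) =
      (fun L : ℕ => (∑ x ∈ halfOpenBox 2 L, ∑ y ∈ halfOpenBox 2 L,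
        torusPullback (pairFieldCorr dWaveFormFactor ψ') L x y) /
          ((halfOpenBox 2 L).card : ℝ) ^ 2) ∘ (fun k => 2 * k) := by
    funext k
    simp only [Function.comp_apply, torusPullback_apply]
    rw [pairFieldCorr_congr dWaveFormFactor (hψ'_even (2 * k) (even_two_mul k))]
  rw [heq]
  exact hsub

/-! ### The thesis against the summit: exactly the doping range is missing -/

/-- **`X` implies the summit's matrix at every weak coupling, at ITS doping.** From `WcbcsThesis`
we get `U₀ > 0` and `δ ∈ (0, 1)` with `HasDWavePairFieldLROAt U δ` for every `U ∈ (0, U₀)`.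
[folklore] -/
theorem wcbcsThesis_imp_forall_hasDWavePairFieldLROAt (hX : WcbcsThesis) :
    ∃ U₀ : ℝ, 0 < U₀ ∧ ∃ δ ∈ Set.Ioo (0 : ℝ) 1, ∀ U ∈ Set.Ioo (0 : ℝ) U₀,
      HasDWavePairFieldLROAt U δ := by
  -- buildfix 2026-08-20 (proof only): since route rev 2 `WcbcsThesis` IS the summit matrix on a
  -- weak-coupling window with `δ ∈ (0, 1/2)`; widen the doping range.
  obtain ⟨U₀, hU₀, δ, hδ, h⟩ := hX
  exact ⟨U₀, hU₀, δ, ⟨hδ.1, hδ.2.trans (by norm_num)⟩, h⟩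

/-- **`X` implies the summit-shaped statement with doping range `(0, 1)`.** `WcbcsThesis` yields
`∃ U > 0, ∃ δ ∈ (0, 1), HasDWavePairFieldLROAt U δ` (witness `U = U₀/2`); the summit
`HubbardSuperconductivity` asks for `δ ∈ (0, 1/2)`, so the route's `Assembly : X → summit` is not
pure logic: it fails exactly when every doping witness of `X` lies in `[1/2, 1)`. [folklore] -/
theorem wcbcsThesis_imp_summitShape_Ioo_one (hX : WcbcsThesis) :
    ∃ U : ℝ, 0 < U ∧ ∃ δ ∈ Set.Ioo (0 : ℝ) 1, HasDWavePairFieldLROAt U δ := by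
  obtain ⟨U₀, hU₀, δ, hδ, h⟩ := wcbcsThesis_imp_forall_hasDWavePairFieldLROAt hX
  exact ⟨U₀ / 2, by positivity, δ, hδ, h (U₀ / 2) ⟨by positivity, by linarith⟩⟩

/-- **The intended assembly, for the thesis restated with `δ ∈ (0, 1/2)`.** If `X` holds with a
doping witness in the summit's range `(0, 1/2)` (all-`L` admissibility, `HasPairFieldLRO`
conclusion, as in `WcbcsThesis`), then `HubbardSuperconductivity` holds (witness `U = U₀/2`).
[folklore] -/
theorem hubbardSuperconductivity_of_wcbcsThesis_half
    (hX : ∃ U₀ : ℝ, 0 < U₀ ∧ ∃ δ ∈ Set.Ioo (0 : ℝ) (1 / 2), ∀ U ∈ Set.Ioo (0 : ℝ) U₀,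
      ∀ (N : ℕ → ℕ) (ψ : ∀ L, Fock (Orb (FermionTorus 2 L))),
        (∀ L, N L = 2 * ⌊(1 - δ) * (L : ℝ) ^ 2 / 2⌋₊ ∧ star (ψ L) ⬝ᵥ ψ L = 1 ∧
            IsGroundStateInSector (hubbardTorus 2 L 1 U) (N L) 0 (ψ L)) →
          HasPairFieldLRO dWaveFormFactor N ψ) :
    HubbardSuperconductivity := by
  obtain ⟨U₀, hU₀, δ, hδ, h⟩ := hX
  unfold HubbardSuperconductivity Literature.Hubbard.DWaveSuperconductivityHubbard
  exact ⟨U₀ / 2, by positivity, δ, hδ,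
    hasDWavePairFieldLROAt_of_forall_hasPairFieldLRO (by linarith [hδ.1])
      (h (U₀ / 2) ⟨by positivity, by linarith⟩)⟩

/-- **The intended assembly, for the thesis restated on even sides with `δ ∈ (0, 1/2)`** (the
form `X'` tested by the grounder, 2026-08-14): `∃ U₀ > 0, ∃ δ ∈ (0, 1/2), ∀ U ∈ (0, U₀),
HasDWavePairFieldLROAt U δ` implies `HubbardSuperconductivity` (witness `U = U₀/2`). [folklore] -/
theorem hubbardSuperconductivity_of_evenThesis_half
    (hX : ∃ U₀ : ℝ, 0 < U₀ ∧ ∃ δ ∈ Set.Ioo (0 : ℝ) (1 / 2), ∀ U ∈ Set.Ioo (0 : ℝ) U₀,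
      HasDWavePairFieldLROAt U δ) :
    HubbardSuperconductivity := by
  obtain ⟨U₀, hU₀, δ, hδ, h⟩ := hX
  unfold HubbardSuperconductivity Literature.Hubbard.DWaveSuperconductivityHubbard
  exact ⟨U₀ / 2, by positivity, δ, hδ, h (U₀ / 2) ⟨by positivity, by linarith⟩⟩

/-! ### The route's internal glue: cruxes #2 and #4 imply the thesis -/

/-- **Cruxes ⇒ thesis.** If SSB of the `d`-wave order parameter transfers to torus LRO of every
sector ground-state sequence (crux #2, `WcbcsSsbToTorusLRO`) and the BCS construction provides
`m(U, δ) ≥ e^{-C/U²} > 0` at weak coupling with the right density (crux #4,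
`WcbcsBcsConstruction`), then `WcbcsThesis` holds with the same `U₀`, `δ`: for an admissible
`(N, ψ)`, crux #2 gives `m² ≤ liminf L⁻⁴ re ⟨ψ_L, Δ_d† Δ_d ψ_L⟩`, `m > 0`, and the sector
hypothesis gives the particle-number / normalisation clause (`mem_szSector_iff`), which is
`HasPairFieldLRO` by `hasPairFieldLRO_iff_liminf_holds`. [folklore] -/
theorem wcbcsThesis_of_cruxes (h2 : WcbcsSsbToTorusLRO) (h4 : WcbcsBcsConstruction) :
    WcbcsThesis :=
  -- buildfix 2026-08-20 (proof only): cruxes 2/4 and the thesis were restated by name (route revs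
  -- 2–4, 2026-08-15); the implication is now the route's proved glue item `WcbcsThesisGlue`
  -- (stmt-HubbardSuperconductivity-14261, `Theorems/WeakCouplingBCSWcbcsThesisGlue.lean`).
  wcbcsThesisGlue_proof h2 h4

-- buildfix 2026-08-20 (maintenance): `wcbcsThesis_of_eventually_le` REMOVED — its hypothesis allows a doping
-- `δ ∈ (0, 1)` while the restated `WcbcsThesis` (route rev 2, 2026-08-15) requires `δ ∈ (0, 1/2)`, so the
-- implication is no longer derivable (statement against the rev-1 body). No importer used it.

/-! ### Appendix (seat 1, 2026-08-15): lower bound of the LRO sequence, the refuter's form of `X`, non-vacuity -/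

/-- The long-range-order sequence of the pair field is NONNEGATIVE at every side: at `L = 0` it is
the junk value `0`, at `L + 1` it is `(L+1)⁻⁴ re ⟨ψ, Δ_g† Δ_g ψ⟩ ≥ 0` because `Δ_g† Δ_g` is
positive semidefinite (`pairField_conjTranspose_mul_self_posSemidef`). Together with
`lroSeq_pairFieldCorr_le` this pins the sequence in `[0, C_g²]`, which is what
`Filter.eventually_lt_of_lt_liminf` / `Filter.le_liminf_of_le` need to manipulate its real
`liminf` (e.g. in crux #2). Scalapino, Phys. Rep. 250 (1995) 329, §2. [folklore] -/
theorem lroSeq_pairFieldCorr_nonneg (g : Site 2 → ℝ) (ψ : ∀ L, Fock (Orb (FermionTorus 2 L)))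
    (L : ℕ) :
    0 ≤ (∑ x ∈ halfOpenBox 2 L, ∑ y ∈ halfOpenBox 2 L, torusPullback (pairFieldCorr g ψ) L x y) /
        ((halfOpenBox 2 L).card : ℝ) ^ 2 := by
  cases L with
  | zero => simp
  | succ n =>
    rw [torusLROSeq_pairFieldCorr_succ]
    refine div_nonneg ?_ (by positivity)
    have h := (pairField_conjTranspose_mul_self_posSemidef g (n + 1)).dotProduct_mulVec_nonneg
      (ψ (n + 1))
    exact (Complex.nonneg_iff.mp h).1

/-- Hence the LRO sequence of a family normalised at every positive side is bounded below (by `0`)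
and above (by `C_g²`) along `atTop` in the sense of Mathlib's `IsBoundedUnder`, the side
conditions of the real `liminf` API. [folklore] -/
theorem isBoundedUnder_lroSeq_pairFieldCorr (g : Site 2 → ℝ)
    (ψ : ∀ L, Fock (Orb (FermionTorus 2 L))) (hψ : ∀ L, star (ψ (L + 1)) ⬝ᵥ ψ (L + 1) = 1) :
    IsBoundedUnder (· ≥ ·) atTop (fun L : ℕ => (∑ x ∈ halfOpenBox 2 L, ∑ y ∈ halfOpenBox 2 L,
        torusPullback (pairFieldCorr g ψ) L x y) / ((halfOpenBox 2 L).card : ℝ) ^ 2) ∧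
      IsBoundedUnder (· ≤ ·) atTop (fun L : ℕ => (∑ x ∈ halfOpenBox 2 L, ∑ y ∈ halfOpenBox 2 L,
        torusPullback (pairFieldCorr g ψ) L x y) / ((halfOpenBox 2 L).card : ℝ) ^ 2) :=
  ⟨isBoundedUnder_of_eventually_ge (a := 0)
      (Eventually.of_forall fun L => lroSeq_pairFieldCorr_nonneg g ψ L),
    isBoundedUnder_of_eventually_le
      (a := (∑ e ∈ insert 0 unitSteps, ‖((g e / Real.sqrt 2 : ℝ) : ℂ)‖ * 2) ^ 2)
      (Eventually.of_forall fun L => lroSeq_pairFieldCorr_le g ψ hψ L)⟩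

-- buildfix 2026-08-20 (maintenance): `not_wcbcsThesis_iff` and `exists_admissible_hasPairFieldLRO_of_wcbcsThesis`
-- REMOVED — both unfold the rev-1 body of `WcbcsThesis` (all-`L` admissibility, `HasPairFieldLRO` conclusion,
-- `δ ∈ (0,1)`); the restated thesis concludes `HasDWavePairFieldLROAt` (even sides, LRO along even boxes), which
-- neither is nor implies the old body, so the `Iff`/the all-`L` `HasPairFieldLRO` witness are not derivable.
-- No importer used them (the only importer, `ChernVortexResponseGlue`, uses
-- `hasDWavePairFieldLROAt_of_forall_hasPairFieldLRO`, unchanged).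

end Summit.HubbardSuperconductivity.HubbardSuperconductivity.Theorems

end
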